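import Mathlib.Algebra.Polynomial.Derivative
import Mathlib.Algebra.Polynomial.Degree.Lemmas
import Mathlib.Algebra.Polynomial.Div
import Mathlib.RingTheory.Coprime.Lemmas
import Mathlib.Tactic.LinearCombination
import Mathlib.Tactic.Ring
import HarnessLib

/-!
# Moh's bound for a sheared binary form (Hauser–Wagner 2014, Lemma 2): the `y`-order after
  `y ↦ y + tz` is at most the height, plus one modulo `p`-th powers

H. Hauser, D. Wagner, *Alternative invariants for the embedded resolution of purely inseparable surface
singularities*, L'Enseignement Math. (2) **60** (2014) 177–224 = arXiv:1403.6789 [cite: HauserWagner2014],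
§6.1 (T), Lemma 2 (print p. 202; arXiv chunk p15 L56 – p16 L37), "due to Moh (cf. Proposition 2, p. 989
in [Moh], or Theorem 3 in [Hauser 2010])":

> **Lemma 2.** Let `F_d` be homogenous of degree `d`. Set `F_d⁺(y,z) = F_d(y + tz, z)` with `t ≠ 0`.
> Then `ord_y(F_d⁺) ≤ height(F_d) + parity(d)`,

where `height(F_d) = deg_y(F_d) − ord_y(F_d)` (§4, print p. 190) — writing
`F_d = Σ_{i=0}^{k} c_i y^{m−i} z^{n+i}` with `c₀ c_k ≠ 0`, `height(F_d) = k` —, `parity(d) = 1` if `p ∣ d`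
and `0` otherwise, and `ord_y(F_d⁺)` is the `y`-order of the CLASS of `F_d⁺` modulo `p`-th powers
(the printed proof: "Since `v ∉ p·ℕ` (otherwise the monomial `y^v z^{d−v}` occurring in the expansion of
`F_d⁺` would be a `p`-th power and thus `ord_y(F_d⁺) > v`)"; for `p ∣ d` a monomial `y^a z^{d−a}` is a
`p`-th power iff `p ∣ a`).  This is the binary-form ("flag") version of Moh's one-blow-up bound `+1` at
`e = 1`; it is the step of the printed proof of [HW14] Prop. 2 / Thm. 2 (i) at which the height of a
purely inseparable surface `x^p + F(y,z)` may RISE by one under a translational move — the kangaroo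
phenomenon in dimension two (Rem. 11, p. 203: the bound is sharp, `p = 2`, `F = y⁵z + y³z³ + …`).

## What is proved (univariate form; every field `K`, no hypothesis on the characteristic)

Dehomogenise `z ↦ 1`: a binary form `F_d = z^n·(Σ_i c_i y^{m−i} z^{i})` corresponds to
`f = Σ_i c_i X^{m−i} ∈ K[X]` with `natDegree f = m = deg_y(F_d)`, `natTrailingDegree f = m − k = ord_y(F_d)`,
so `height(F_d) = natDegree f − natTrailingDegree f`; the shear `y ↦ y + tz` is `f ↦ f.comp (X + C t)`, and
`ord_y(F_d⁺)` as a polynomial is `natTrailingDegree (f.comp (X + C t))`.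

* `HauserWagner2014.natTrailingDegree_comp_X_add_C_le` — **case `parity = 0` / the polynomial order**: for
  `f ≠ 0` and `t ≠ 0`, `natTrailingDegree (f.comp (X + C t)) ≤ natDegree f − natTrailingDegree f`
  (the multiplicity of the non-zero root `−t` of `f = X^{m−k}·h` is at most `deg h = k`).
* `HauserWagner2014.exists_coeff_comp_X_add_C_ne_zero` — **case `parity = 1` / the order modulo `p`-th
  powers**: if `derivative f ≠ 0` (for a CLEANED form with `p ∣ d`, i.e. one without monomials `y^a z^{d−a}`,
  `p ∣ a`, this holds as soon as `f` is not constant) and `t ≠ 0`, there is an exponent `a` with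
  `coeff (f.comp (X + C t)) a ≠ 0`, `(a : K) ≠ 0` (so `p ∤ a` in characteristic `p`: the monomial survives the
  deletion of `p`-th powers) and `a ≤ natDegree f − natTrailingDegree f + 1` — i.e. the `y`-order of the class
  of `F_d⁺` is at most `height(F_d) + 1`.  The proof is the printed one: `g = ∂_y F_d⁺ = (∂_y F_d)⁺` is
  divisible by `(y + tz)^{m−k−1}` and by `y^{w−1}` (`w` the least exponent with `p ∤ w` and non-zero
  coefficient), `y` and `y + tz` are coprime as `t ≠ 0`, and `deg g ≤ m − 1`.

Scope (honest): the univariate/dehomogenised form; the dictionary with the tree's bivariate vocabulary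
`HauserWagner2014.height` / `ordVar` / `degAlong` of `PointBlowupHeight.lean` (expansions as `MvPolynomial`)
is the two sentences above and is not formalised here.  Theorems only (D-0026: no new fact).  Filed by the
res-hironaka literature seat res-lit-5 for the L chain w43's S2 class cut (S2iM, "Hauser–Wagner descent"),
whose Prop-2 chain uses exactly this inequality.
-/

open Polynomial

namespace Literature.AlgebraicGeometry.Resolution

namespace HauserWagner2014

variable {K : Type*} [Field K]

/-- `X` and `X + C t` are coprime in `K[X]` for `t ≠ 0` (`(−t⁻¹)·X + t⁻¹·(X + t) = 1`). [folklore] -/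
private theorem isCoprime_X_X_add_C {t : K} (ht : t ≠ 0) : IsCoprime (X : K[X]) (X + C t) := by
  refine ⟨-C t⁻¹, C t⁻¹, ?_⟩
  have : C t⁻¹ * C t = (1 : K[X]) := by rw [← C_mul, inv_mul_cancel₀ ht, C_1]
  linear_combination this

/-- `X ^ natTrailingDegree f` divides `f`. [folklore] -/
private theorem X_pow_natTrailingDegree_dvd (f : K[X]) : X ^ f.natTrailingDegree ∣ f :=
  X_pow_dvd_iff.mpr fun _ hd => coeff_eq_zero_of_lt_natTrailingDegree hd

/-- If `a ∣ b` then `a.comp q ∣ b.comp q`. [folklore] -/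
private theorem comp_dvd_comp_of_dvd {a b : K[X]} (h : a ∣ b) (q : K[X]) : a.comp q ∣ b.comp q := by
  obtain ⟨c, rfl⟩ := h
  exact ⟨c.comp q, mul_comp a c q⟩

/-- **[HW14] Lemma 2, the polynomial order (`parity(d) = 0`): the multiplicity of a non-zero root is at most
the height.**  For `f ≠ 0` and `t ≠ 0`, `natTrailingDegree (f.comp (X + C t)) ≤ natDegree f − natTrailingDegree f`:
writing `f = X^u · h` with `u = natTrailingDegree f`, `f.comp (X + C t) = (X + C t)^u · h.comp (X + C t)` has
trailing degree that of `h.comp (X + C t)`, which is at most `natDegree h = natDegree f − u`.  In Hauser–Wagner's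
words (binary form `F_d`, `f = F_d(y, 1)`): `ord_y(F_d(y + tz, z)) ≤ height(F_d)` as polynomials.
[cite: HauserWagner2014, §6.1 Lemma 2 (b) (p. 202)] [cite: Moh1987, §1 Proposition 2] -/
theorem natTrailingDegree_comp_X_add_C_le {f : K[X]} (hf : f ≠ 0) {t : K} (ht : t ≠ 0) :
    (f.comp (X + C t)).natTrailingDegree ≤ f.natDegree - f.natTrailingDegree := by
  set u := f.natTrailingDegree with hu
  obtain ⟨h, hfh⟩ := X_pow_natTrailingDegree_dvd f
  have hh0 : h ≠ 0 := by rintro rfl; exact hf (by rw [hfh, mul_zero])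
  have hXu0 : (X : K[X]) ^ u ≠ 0 := pow_ne_zero _ X_ne_zero
  have hq1 : (X + C t : K[X]).natDegree = 1 := natDegree_X_add_C t
  have hq0 : (X + C t : K[X]) ≠ 0 := by
    intro h0; have := congrArg natDegree h0; rw [hq1, natDegree_zero] at this; exact one_ne_zero this
  -- degrees of f = X^u * h
  have hdeg : f.natDegree = u + h.natDegree := by
    conv_lhs => rw [hfh]
    rw [natDegree_mul hXu0 hh0, natDegree_X_pow]
  -- the composition
  have hcomp : f.comp (X + C t) = (X + C t) ^ u * h.comp (X + C t) := by
    conv_lhs => rw [hfh]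
    rw [mul_comp, X_pow_comp]
  have hhc0 : h.comp (X + C t) ≠ 0 := by
    intro h0
    rw [comp_eq_zero_iff] at h0
    rcases h0 with h0 | ⟨-, h0⟩
    · exact hh0 h0
    · have := congrArg natDegree h0
      rw [hq1, natDegree_C] at this
      exact one_ne_zero this
  have hpow0 : (X + C t : K[X]) ^ u ≠ 0 := pow_ne_zero _ hq0
  have htr_pow : ((X + C t : K[X]) ^ u).natTrailingDegree = 0 := by
    apply natTrailingDegree_eq_zero_of_constantCoeff_ne_zero
    rw [map_pow]
    refine pow_ne_zero _ ?_
    rw [map_add, constantCoeff_apply, constantCoeff_apply, coeff_X_zero, coeff_C_zero, zero_add]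
    exact ht
  rw [hcomp, natTrailingDegree_mul hpow0 hhc0, htr_pow, zero_add]
  calc (h.comp (X + C t)).natTrailingDegree ≤ (h.comp (X + C t)).natDegree := natTrailingDegree_le_natDegree _
    _ = h.natDegree := by rw [natDegree_comp, hq1, mul_one]
    _ = f.natDegree - u := by rw [hdeg]; omega

/-- **[HW14] Lemma 2, the order modulo `p`-th powers (`parity(d) = 1`): at most the height plus one.**
For `t ≠ 0` and `derivative f ≠ 0` there is an exponent `a` with `coeff (f.comp (X + C t)) a ≠ 0`,
`(a : K) ≠ 0` and `a ≤ natDegree f − natTrailingDegree f + 1`.  In characteristic `p` the condition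
`(a : K) ≠ 0` says `p ∤ a`, so for a binary form `F_d` with `p ∣ d` the monomial `y^a z^{d−a}` of
`F_d(y + tz, z)` is NOT a `p`-th power and survives in the class modulo `p`-th powers: `ord_y` of that class is
`≤ height(F_d) + 1` — the printed statement; the hypothesis `derivative f ≠ 0` holds for every cleaned `F_d` with
`p ∣ d` that is not a monomial `c·z^d` (all its `y`-exponents are prime to `p`).  Printed proof, followed here:
`g := ∂(f.comp (X + C t)) = (∂f).comp (X + C t)` is non-zero of degree `≤ natDegree f − 1`, divisible by
`(X + C t)^{u−1}` (`u = natTrailingDegree f`, as `X^{u−1} ∣ ∂f`) and by `X^b` (`b = natTrailingDegree g`);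
`X` and `X + C t` being coprime, `b + (u − 1) ≤ natDegree f − 1`; and `coeff g b = (b+1)·coeff_{b+1} ≠ 0`
gives `a = b + 1`.  [cite: HauserWagner2014, §6.1 Lemma 2 (a) (p. 202)] [cite: Moh1987, §1 Proposition 2]
[cite: Hauser2010, §F Proposition (Moh's bound)] -/
theorem exists_coeff_comp_X_add_C_ne_zero {f : K[X]} (hf' : derivative f ≠ 0) {t : K} (ht : t ≠ 0) :
    ∃ a : ℕ, (f.comp (X + C t)).coeff a ≠ 0 ∧ (a : K) ≠ 0 ∧
      a ≤ f.natDegree - f.natTrailingDegree + 1 := by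
  have hf : f ≠ 0 := by rintro rfl; exact hf' derivative_zero
  set u := f.natTrailingDegree with hu
  set m := f.natDegree with hm
  obtain ⟨h, hfh⟩ := X_pow_natTrailingDegree_dvd f
  have hq1 : (X + C t : K[X]).natDegree = 1 := natDegree_X_add_C t
  -- g = derivative of the sheared polynomial
  set g := derivative (f.comp (X + C t)) with hg
  have hg' : g = (derivative f).comp (X + C t) := by
    rw [hg, derivative_comp, derivative_X_add_C, one_mul]
  have hg0 : g ≠ 0 := by
    rw [hg']
    intro h0
    rw [comp_eq_zero_iff] at h0
    rcases h0 with h0 | ⟨-, h0⟩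
    · exact hf' h0
    · have := congrArg natDegree h0
      rw [hq1, natDegree_C] at this
      exact one_ne_zero this
  -- degree of g
  have hm1 : 1 ≤ m := by
    by_contra hlt
    have hm0 : f.natDegree = 0 := by omega
    exact hf' (by rw [eq_C_of_natDegree_eq_zero hm0, derivative_C])
  have hgdeg : g.natDegree ≤ m - 1 := by
    rw [hg', natDegree_comp, hq1, mul_one]
    exact natDegree_derivative_le f
  -- (X + C t)^(u-1) ∣ g
  have hdvd1 : (X + C t) ^ (u - 1) ∣ g := by
    have hXf' : X ^ (u - 1) ∣ derivative f := by
      rw [hfh, derivative_mul, derivative_X_pow]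
      refine dvd_add ?_ ?_
      · exact Dvd.dvd.mul_right (Dvd.intro_left _ rfl) _
      · exact Dvd.dvd.mul_right (pow_dvd_pow X (Nat.sub_le u 1)) _
    have := comp_dvd_comp_of_dvd hXf' (X + C t)
    rwa [X_pow_comp, ← hg'] at this
  -- X^b ∣ g, b the trailing degree
  set b := g.natTrailingDegree with hb
  have hdvd2 : X ^ b ∣ g := X_pow_natTrailingDegree_dvd g
  -- coprimality and the degree count
  have hcop : IsCoprime ((X : K[X]) ^ b) ((X + C t) ^ (u - 1)) := (isCoprime_X_X_add_C ht).pow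
  have hdvd : X ^ b * (X + C t) ^ (u - 1) ∣ g := hcop.mul_dvd hdvd2 hdvd1
  have hdegprod : (X ^ b * (X + C t) ^ (u - 1) : K[X]).natDegree = b + (u - 1) := by
    have h1 : (X : K[X]) ^ b ≠ 0 := pow_ne_zero _ X_ne_zero
    have h2 : (X + C t : K[X]) ^ (u - 1) ≠ 0 := pow_ne_zero _ (X_add_C_ne_zero t)
    rw [natDegree_mul h1 h2, natDegree_X_pow, natDegree_pow, hq1, mul_one]
  have hle : b + (u - 1) ≤ m - 1 := by
    have := natDegree_le_of_dvd hdvd hg0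
    rw [hdegprod] at this
    exact this.trans hgdeg
  have hum : u ≤ m := natTrailingDegree_le_natDegree f
  -- the witness a = b + 1
  have hcoef : g.coeff b ≠ 0 := by
    rw [hb]; exact mt coeff_natTrailingDegree_eq_zero.mp hg0
  rw [hg, coeff_derivative] at hcoef
  refine ⟨b + 1, left_ne_zero_of_mul hcoef, ?_, by omega⟩
  have := right_ne_zero_of_mul hcoef
  exact_mod_cast this

end HauserWagner2014

end Literature.AlgebraicGeometry.Resolution
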